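import Summits.NavierStokesRegularity.NavierStokesRegularity.Theorems.RecurrentProfilesRecurrentReductionOrbit
import Literature.Analysis.FluidPDE.ScalingUniformRecurrence
import HarnessLib

/-!
# Crux `ForcedSymmetry` (stmt-NavierStokesRegularity-4052), line `closing-dichotomy` (gen c10.1) —
# stub `stub_hullAlmostPeriodic`: almost periodicity along the scaling orbit is inherited by hull points

Theorems-only file (no definitions, no named facts).  Notation: `Φ_r W := nsRescale (exp r) W`,
`Φ_r W (t, x) = e^r W(e^{2r} t, e^r x)`, is the Navier–Stokes scaling flow in logarithmic scale;
`‖F‖_K := ‖F‖_{L³(K)}` for a compact `K ⊆ {t ≤ 0} × ℝ³`; "`W ∈ L³_loc`" means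
`W ∈ L³(Q(0, R))` for every backward parabolic cylinder `Q(0, R)`, `R > 0`.

**Statement.**  Let `U, V ∈ L³_loc`.  Suppose the scaling orbit of `U` is almost periodic ALONG
ITSELF: for every `ε > 0` and compact `K ⊆ {t ≤ 0} × ℝ³` there is `L > 0` such that every window
`[a, a + L]` contains `σ` with `sup_s ‖Φ_σ (Φ_s U) − Φ_s U‖_K ≤ ε`; and suppose `V` is a hull point
of `U`: for every `ε > 0` and compact `K` some orbit point `Φ_τ U` is `ε`-close to `V` in `L³(K)`.
Then the orbit of `V` is almost periodic along itself, with the same almost periods.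

**Proof** (two triangle inequalities and the exact `L³` scaling law at FIXED scales; no
minimality, no compactness, no Navier–Stokes input).  Fix `ε, K`, take `L` and, for a window
`[a, a + L]`, the almost period `σ` of `U` (with the same `ε`).  Fix `s` and `η > 0`.  The exact
scaling law `‖Φ W‖_{L³(K)} = A(c) ‖W‖_{L³(Φ_c K)}` (`eLpNorm_nsRescale_restrict`, `Φ = nsRescale c`,
`Φ_c K` the parabolically dilated compact set, `0 < A(c) < ∞`) gives `δ > 0` with
`‖X − Y‖_{L³(Φ_c K)} ≤ δ ⇒ ‖nsRescale c X − nsRescale c Y‖_{L³(K)} ≤ η/2` for the two scales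
`c = e^s` and `c = e^s e^σ`.  Choose `τ` (hull hypothesis) with `‖Φ_τ U − V‖ ≤ δ` on the compact
set `Φ_{e^s} K ∪ Φ_{e^s e^σ} K ⊆ {t ≤ 0} × ℝ³`.  Then
`‖Φ_σ Φ_s V − Φ_s V‖_K ≤ ‖Φ_σ Φ_{τ+s} U − Φ_σ Φ_s V‖_K + ‖Φ_σ Φ_{τ+s} U − Φ_{τ+s} U‖_K + ‖Φ_{τ+s} U − Φ_s V‖_K ≤ η/2 + ε + η/2`
(the middle term by the hypothesis on `U` at log-scale `τ + s`; `Φ_s Φ_τ = Φ_{τ+s}` is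
`nsRescale_mul` + `Real.exp_add`), and `η → 0` (`ENNReal.le_of_forall_pos_le_add`).  The
a.e.-measurability needed by the triangle inequality comes from `U, V ∈ L³_loc`, the invariance of
`L³_loc` under the scaling (`memLp_three_zoom`) and `volume|_K ≤ volume|_{Q(0, n+1)}` for compact
`K ⊆ {t ≤ 0} × ℝ³` (the hyperplane `{t = 0}` is null).

References: H. Furstenberg, *Recurrence in Ergodic Theory and Combinatorial Number Theory* (1981),
Ch. 1 §4 (uniform recurrence, minimal sets and their hulls) [Furstenberg1981]; the statement is the
`L³_loc` form of "every function in the hull of a Bohr almost periodic function is almost periodic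
with the same almost periods" (A. M. Fink, *Almost Periodic Differential Equations*, LNM 377, Ch. 1).
-/

noncomputable section

-- the sub-problem namespace repeats the summit name (D-0017 layout `Summit.<S>.<P>.Theorems`)
set_option linter.dupNamespace false

namespace Summit.NavierStokesRegularity.NavierStokesRegularity.Theorems

open MeasureTheory Set Function Filter Topology TopologicalSpace Metric
open Literature.Analysis Literature.Analysis.FluidPDE
open scoped NNReal ENNReal

/-- Local notation for physical space `ℝ³ = EuclideanSpace ℝ (Fin 3)` (the registered stub
signature is spelled with it). -/
local notation "ℝ³" => EuclideanSpace ℝ (Fin 3)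

/-! ### Bookkeeping lemmas -/

/-- **`volume|_K ≤ volume|_{Q(0, n+1)}` for compact `K ⊆ {t ≤ 0} × ℝ³`**: a compact subset of the
CLOSED lower half-space lies in some `Q(0, n+1)` up to the null hyperplane `{t = 0} × ℝ³`.
[folklore] -/
private theorem hullAP_restrict_le {K : Set (ℝ × ℝ³)} (hK : IsCompact K)
    (hKH : K ⊆ Set.Iic (0 : ℝ) ×ˢ (Set.univ : Set ℝ³)) :
    ∃ n : ℕ, volume.restrict K ≤ volume.restrict (parabolicCylinder ((n : ℝ) + 1) (0 : ℝ × ℝ³)) := by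
  -- adapted from `exists_eLpNorm_restrict_le_of_isCompact` (RecurrentProfilesRecurrentReductionOrbit)
  obtain ⟨R, hR⟩ := hK.isBounded.subset_closedBall (0 : ℝ × ℝ³)
  obtain ⟨n, hn⟩ := exists_nat_ge R
  set Q₀ : Set (ℝ × ℝ³) := parabolicCylinder ((n : ℝ) + 1) (0 : ℝ × ℝ³) with hQ₀
  set N : Set (ℝ × ℝ³) := ({0} : Set ℝ) ×ˢ (univ : Set ℝ³) with hN
  have hsub : K ⊆ Q₀ ∪ N := by
    intro z hz
    have hzR : ‖z‖ ≤ R := by simpa [mem_closedBall, dist_zero_right] using hR hz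
    have h1 : |z.1| ≤ R := (norm_fst_le z).trans hzR
    have h2 : ‖z.2‖ ≤ R := (norm_snd_le z).trans hzR
    have hz0 : z.1 ≤ 0 := (hKH hz).1
    rcases hz0.lt_or_eq with hlt | heq
    · left
      rw [hQ₀, SuitableCompactness.mem_parabolicCylinder_zero]
      refine ⟨⟨?_, hlt⟩, by linarith⟩
      have h3 : -R ≤ z.1 := (abs_le.1 h1).1
      nlinarith [n.cast_nonneg (α := ℝ)]
    · right
      exact ⟨heq, mem_univ _⟩
  have hnull : volume N = 0 := by
    rw [hN, Measure.volume_eq_prod, Measure.prod_prod, Real.volume_singleton, zero_mul]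
  have hae : (Q₀ ∪ N : Set (ℝ × ℝ³)) =ᵐ[volume] Q₀ := by
    have h := (ae_eq_refl Q₀).union (ae_eq_empty.2 hnull)
    rwa [union_empty] at h
  refine ⟨n, ?_⟩
  calc volume.restrict K ≤ volume.restrict (Q₀ ∪ N) := Measure.restrict_mono hsub le_rfl
    _ = volume.restrict Q₀ := Measure.restrict_congr_set hae

/-- **`L³_loc` is invariant under the scaling**: if `W ∈ L³(Q(0, R))` for every `R > 0`, then so is
`nsRescale c W` for `c > 0` (`nsRescale c W = c W ∘ Φ_c` and `Φ_c Q(0, R) = Q(0, c R)`). [folklore] -/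
private theorem hullAP_memLp_nsRescale {W : ℝ → ℝ³ → ℝ³}
    (hW : ∀ R : ℝ, 0 < R → MemLp (uncurry W) 3 (volume.restrict (parabolicCylinder R (0 : ℝ × ℝ³))))
    {c : ℝ} (hc : 0 < c) (R : ℝ) (hR : 0 < R) :
    MemLp (uncurry (nsRescale c W)) 3 (volume.restrict (parabolicCylinder R (0 : ℝ × ℝ³))) := by
  -- adapted from `recurrentReduction_proof` (`hPz`)
  rw [nsRescale_eq_zoom]
  exact memLp_three_zoom hc (hW _ (mul_pos hc hR))

/-- **Orbit points of an `L³_loc` field are a.e.-strongly measurable on `volume|_K`** for every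
compact `K ⊆ {t ≤ 0} × ℝ³` (`L³_loc` invariance + `volume|_K ≤ volume|_{Q(0, n+1)}`). [folklore] -/
private theorem hullAP_aestronglyMeasurable {W : ℝ → ℝ³ → ℝ³}
    (hW : ∀ R : ℝ, 0 < R → MemLp (uncurry W) 3 (volume.restrict (parabolicCylinder R (0 : ℝ × ℝ³))))
    {K : Set (ℝ × ℝ³)} (hK : IsCompact K) (hKH : K ⊆ Set.Iic (0 : ℝ) ×ˢ Set.univ) {c : ℝ}
    (hc : 0 < c) :
    AEStronglyMeasurable (fun z : ℝ × ℝ³ => nsRescale c W z.1 z.2) (volume.restrict K) := by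
  obtain ⟨n, hn⟩ := hullAP_restrict_le hK hKH
  exact (hullAP_memLp_nsRescale hW hc _ (by positivity)).aestronglyMeasurable.mono_measure hn

/-- **Smallness transport through a FIXED rescaling** (the exact scaling law
`‖nsRescale c W‖_{L³(K)} = A(c) ‖W‖_{L³(Φ_c K)}`, `0 < A(c) < ∞`, `eLpNorm_nsRescale_restrict`):
for `c > 0`, a set `K` and a target `0 < η < ∞` there is `δ > 0` such that
`‖X − Y‖_{L³(Φ_c K)} ≤ δ` forces `‖nsRescale c X − nsRescale c Y‖_{L³(K)} ≤ η`. [folklore] -/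
private theorem hullAP_small {c : ℝ} (hc : 0 < c) (K : Set (ℝ × ℝ³)) {η : ℝ≥0∞} (hη0 : η ≠ 0)
    (hηT : η ≠ ⊤) :
    ∃ δ : ℝ, 0 < δ ∧ ∀ X Y : ℝ → ℝ³ → ℝ³,
      eLpNorm (fun z : ℝ × ℝ³ => X z.1 z.2 - Y z.1 z.2) 3
          (volume.restrict (stAffine (c ^ 2) c 0 (0 : ℝ³) '' K)) ≤ ENNReal.ofReal δ →
        eLpNorm (fun z : ℝ × ℝ³ => nsRescale c X z.1 z.2 - nsRescale c Y z.1 z.2) 3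
          (volume.restrict K) ≤ η := by
  -- adapted from `IsScalingUniformlyRecurrent.nsRescale` (Literature/Analysis/FluidPDE/ScalingUniformRecurrence)
  set A : ℝ≥0∞ := ‖c‖ₑ * (ENNReal.ofReal (c ^ 2 * c ^ Module.finrank ℝ ℝ³)⁻¹) ^ (1 / (3 : ℝ≥0∞)).toReal
    with hA
  have hAtop : A ≠ ⊤ :=
    ENNReal.mul_ne_top enorm_ne_top (ENNReal.rpow_ne_top_of_nonneg (by norm_num) ENNReal.ofReal_ne_top)
  have hA0 : A ≠ 0 := by
    refine mul_ne_zero ?_ ?_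
    · simpa using hc.ne'
    · exact (ENNReal.rpow_pos (ENNReal.ofReal_pos.2 (by positivity)) ENNReal.ofReal_ne_top).ne'
  have hApos : 0 < A.toReal := ENNReal.toReal_pos hA0 hAtop
  have hηpos : 0 < η.toReal := ENNReal.toReal_pos hη0 hηT
  refine ⟨η.toReal / A.toReal, div_pos hηpos hApos, fun X Y hXY => ?_⟩
  have h1 : (fun z : ℝ × ℝ³ => nsRescale c X z.1 z.2 - nsRescale c Y z.1 z.2) =
      fun z : ℝ × ℝ³ => nsRescale c (X - Y) z.1 z.2 := by
    rw [nsRescale_sub]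
    rfl
  rw [h1, eLpNorm_nsRescale_restrict hc, ← hA]
  calc A * eLpNorm (fun z : ℝ × ℝ³ => (X - Y) z.1 z.2) 3
        (volume.restrict (stAffine (c ^ 2) c 0 (0 : ℝ³) '' K))
      ≤ A * ENNReal.ofReal (η.toReal / A.toReal) := mul_le_mul' le_rfl hXY
    _ = η := by
      rw [← ENNReal.ofReal_toReal hAtop, ← ENNReal.ofReal_mul hApos.le, ENNReal.toReal_ofReal hApos.le,
        mul_div_cancel₀ _ hApos.ne', ENNReal.ofReal_toReal hηT]

/-- **Triangle inequality in `L³` through two intermediate points** (first leg written with the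
flipped difference): `‖f − k‖ ≤ ‖g − f‖ + ‖g − h‖ + ‖h − k‖`. [folklore] -/
private theorem hullAP_triangle {μ : Measure (ℝ × ℝ³)} {f g h k : ℝ × ℝ³ → ℝ³}
    (hf : AEStronglyMeasurable f μ) (hg : AEStronglyMeasurable g μ) (hh : AEStronglyMeasurable h μ)
    (hk : AEStronglyMeasurable k μ) :
    eLpNorm (fun z => f z - k z) 3 μ ≤
      eLpNorm (fun z => g z - f z) 3 μ + eLpNorm (fun z => g z - h z) 3 μ +
        eLpNorm (fun z => h z - k z) 3 μ := by
  have e : (fun z => f z - k z) = -(fun z => g z - f z) + (fun z => g z - h z) + fun z => h z - k z := by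
    funext z
    simp only [Pi.add_apply, Pi.neg_apply]
    abel
  rw [e]
  calc eLpNorm (-(fun z => g z - f z) + (fun z => g z - h z) + fun z => h z - k z) 3 μ
      ≤ eLpNorm (-(fun z => g z - f z) + fun z => g z - h z) 3 μ + eLpNorm (fun z => h z - k z) 3 μ :=
        eLpNorm_add_le (((hg.sub hf).neg).add (hg.sub hh)) (hh.sub hk) (by norm_num)
    _ ≤ eLpNorm (-(fun z => g z - f z)) 3 μ + eLpNorm (fun z => g z - h z) 3 μ +
          eLpNorm (fun z => h z - k z) 3 μ :=
        add_le_add (eLpNorm_add_le (hg.sub hf).neg (hg.sub hh) (by norm_num)) le_rfl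
    _ = eLpNorm (fun z => g z - f z) 3 μ + eLpNorm (fun z => g z - h z) 3 μ +
          eLpNorm (fun z => h z - k z) 3 μ := by
        rw [eLpNorm_neg]

/-! ### The registered stub -/

/-- **Stub `stub_hullAlmostPeriodic`** (registered stub of crux stmt-NavierStokesRegularity-4052,
line `closing-dichotomy`, gen c10.1; known type): **almost periodicity along the orbit is inherited
by hull points, with the same almost periods.**  If `U, V ∈ L³_loc`, the scaling orbit of `U` is
almost periodic ALONG ITSELF (for every `ε`, compact `K ⊆ {t ≤ 0} × ℝ³`: relatively dense
log-scales `σ` with `sup_s ‖Φ_σ (Φ_s U) − Φ_s U‖_{L³(K)} ≤ ε`) and `V` is a hull point of `U`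
(orbit points `Φ_τ U` come arbitrarily close to `V` in every `L³(K)`), then the orbit of `V` is
almost periodic along itself.  Proof: fix `ε, K`, take `L` and, for a window `[a, a+L]`, the almost
period `σ` of `U`; for `s` and `η > 0` choose `τ` with `Φ_τ U` `δ`-close to `V` on the compact set
`Φ_{e^s} K ∪ Φ_{e^s e^σ} K`, `δ` given by the exact scaling law at the fixed scales `e^s`,
`e^s e^σ` (`eLpNorm_nsRescale_restrict`); then
`‖Φ_σ Φ_s V − Φ_s V‖_{L³(K)} ≤ η/2 + ‖Φ_σ Φ_{τ+s} U − Φ_{τ+s} U‖_{L³(K)} + η/2 ≤ η/2 + ε + η/2`, and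
`η → 0`.  No Navier–Stokes input, no minimality, no compactness.
[cite: Furstenberg1981, Ch. 1 §4] -/
theorem stub_hullAlmostPeriodic :
    ∀ (U V : ℝ → ℝ³ → ℝ³),
      (∀ R : ℝ, 0 < R → MemLp (uncurry U) 3 (volume.restrict (parabolicCylinder R (0 : ℝ × ℝ³)))) →
      (∀ R : ℝ, 0 < R → MemLp (uncurry V) 3 (volume.restrict (parabolicCylinder R (0 : ℝ × ℝ³)))) →
      (∀ ε : ℝ, 0 < ε → ∀ K : Set (ℝ × ℝ³), IsCompact K → K ⊆ Set.Iic (0 : ℝ) ×ˢ Set.univ →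
        ∃ L : ℝ, 0 < L ∧ ∀ a : ℝ, ∃ σ ∈ Set.Icc a (a + L), ∀ s : ℝ,
          eLpNorm (fun z : ℝ × ℝ³ =>
              nsRescale (Real.exp σ) (nsRescale (Real.exp s) U) z.1 z.2 - nsRescale (Real.exp s) U z.1 z.2) 3
            (volume.restrict K) ≤ ENNReal.ofReal ε) →
      (∀ ε : ℝ, 0 < ε → ∀ K : Set (ℝ × ℝ³), IsCompact K → K ⊆ Set.Iic (0 : ℝ) ×ˢ Set.univ →
        ∃ τ : ℝ, eLpNorm (fun z : ℝ × ℝ³ => nsRescale (Real.exp τ) U z.1 z.2 - V z.1 z.2) 3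
          (volume.restrict K) ≤ ENNReal.ofReal ε) →
      ∀ ε : ℝ, 0 < ε → ∀ K : Set (ℝ × ℝ³), IsCompact K → K ⊆ Set.Iic (0 : ℝ) ×ˢ Set.univ →
        ∃ L : ℝ, 0 < L ∧ ∀ a : ℝ, ∃ σ ∈ Set.Icc a (a + L), ∀ s : ℝ,
          eLpNorm (fun z : ℝ × ℝ³ =>
              nsRescale (Real.exp σ) (nsRescale (Real.exp s) V) z.1 z.2 - nsRescale (Real.exp s) V z.1 z.2) 3
            (volume.restrict K) ≤ ENNReal.ofReal ε := by
  intro U V hU hV hap hhull ε hε K hK hKH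
  -- the almost periods of `U` (same `ε`, same `K`) work for `V`
  obtain ⟨L, hL, hwin⟩ := hap ε hε K hK hKH
  refine ⟨L, hL, fun a => ?_⟩
  obtain ⟨σ, hσ, hσU⟩ := hwin a
  refine ⟨σ, hσ, fun s => ?_⟩
  refine ENNReal.le_of_forall_pos_le_add fun η hη _ => ?_
  -- the two fixed scales `e^s` and `e^s e^σ`, and the target `η/2`
  have hc₁ : 0 < Real.exp s := Real.exp_pos s
  have hc₂ : 0 < Real.exp s * Real.exp σ := mul_pos (Real.exp_pos s) (Real.exp_pos σ)
  have hη2 : ((η : ℝ≥0∞) / 2) ≠ 0 := (ENNReal.half_pos (ENNReal.coe_ne_zero.2 hη.ne')).ne'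
  have hη2T : ((η : ℝ≥0∞) / 2) ≠ ⊤ := ne_top_of_le_ne_top ENNReal.coe_ne_top ENNReal.half_le_self
  obtain ⟨δ₁, hδ₁, hδ₁W⟩ := hullAP_small hc₁ K hη2 hη2T
  obtain ⟨δ₂, hδ₂, hδ₂W⟩ := hullAP_small hc₂ K hη2 hη2T
  -- the dilated compact set `Φ_{e^s} K ∪ Φ_{e^s e^σ} K ⊆ {t ≤ 0} × ℝ³`
  have hK'c : IsCompact (stAffine (Real.exp s ^ 2) (Real.exp s) 0 (0 : ℝ³) '' K ∪
      stAffine ((Real.exp s * Real.exp σ) ^ 2) (Real.exp s * Real.exp σ) 0 (0 : ℝ³) '' K) :=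
    (hK.image (continuous_stAffine _ _ _ _)).union (hK.image (continuous_stAffine _ _ _ _))
  have hK'H : stAffine (Real.exp s ^ 2) (Real.exp s) 0 (0 : ℝ³) '' K ∪
      stAffine ((Real.exp s * Real.exp σ) ^ 2) (Real.exp s * Real.exp σ) 0 (0 : ℝ³) '' K ⊆
        Set.Iic (0 : ℝ) ×ˢ Set.univ :=
    union_subset (image_stAffine_sq_subset_Iic_prod_univ _ hKH)
      (image_stAffine_sq_subset_Iic_prod_univ _ hKH)
  -- the hull point: an orbit point `Φ_τ U` close to `V` on the dilated set
  obtain ⟨τ, hτ⟩ := hhull (min δ₁ δ₂) (lt_min hδ₁ hδ₂) _ hK'c hK'H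
  have hW₁ : eLpNorm (fun z : ℝ × ℝ³ => nsRescale (Real.exp τ) U z.1 z.2 - V z.1 z.2) 3
      (volume.restrict (stAffine (Real.exp s ^ 2) (Real.exp s) 0 (0 : ℝ³) '' K)) ≤ ENNReal.ofReal δ₁ :=
    (eLpNorm_mono_measure _ (Measure.restrict_mono subset_union_left le_rfl)).trans
      (hτ.trans (ENNReal.ofReal_le_ofReal (min_le_left _ _)))
  have hW₂ : eLpNorm (fun z : ℝ × ℝ³ => nsRescale (Real.exp τ) U z.1 z.2 - V z.1 z.2) 3
      (volume.restrict (stAffine ((Real.exp s * Real.exp σ) ^ 2) (Real.exp s * Real.exp σ) 0 (0 : ℝ³) '' K)) ≤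
        ENNReal.ofReal δ₂ :=
    (eLpNorm_mono_measure _ (Measure.restrict_mono subset_union_right le_rfl)).trans
      (hτ.trans (ENNReal.ofReal_le_ofReal (min_le_right _ _)))
  -- the three legs: `Φ_s Φ_τ = Φ_{τ+s}` (`nsRescale_mul`, `Real.exp_add`)
  have ht3 := hδ₁W (nsRescale (Real.exp τ) U) V hW₁
  have ht1 := hδ₂W (nsRescale (Real.exp τ) U) V hW₂
  have ht2 := hσU (τ + s)
  rw [← nsRescale_mul, ← Real.exp_add] at ht3
  rw [nsRescale_mul, nsRescale_mul, ← nsRescale_mul (Real.exp τ), ← Real.exp_add] at ht1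
  -- a.e.-measurability of the four orbit points on `volume|_K`
  have hf : AEStronglyMeasurable
      (fun z : ℝ × ℝ³ => nsRescale (Real.exp σ) (nsRescale (Real.exp s) V) z.1 z.2) (volume.restrict K) :=
    hullAP_aestronglyMeasurable (hullAP_memLp_nsRescale hV hc₁) hK hKH (Real.exp_pos σ)
  have hg : AEStronglyMeasurable
      (fun z : ℝ × ℝ³ => nsRescale (Real.exp σ) (nsRescale (Real.exp (τ + s)) U) z.1 z.2)
      (volume.restrict K) :=
    hullAP_aestronglyMeasurable (hullAP_memLp_nsRescale hU (Real.exp_pos (τ + s))) hK hKH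
      (Real.exp_pos σ)
  have hh : AEStronglyMeasurable (fun z : ℝ × ℝ³ => nsRescale (Real.exp (τ + s)) U z.1 z.2)
      (volume.restrict K) :=
    hullAP_aestronglyMeasurable hU hK hKH (Real.exp_pos (τ + s))
  have hk : AEStronglyMeasurable (fun z : ℝ × ℝ³ => nsRescale (Real.exp s) V z.1 z.2)
      (volume.restrict K) :=
    hullAP_aestronglyMeasurable hV hK hKH hc₁
  -- two triangle inequalities and `η/2 + ε + η/2 = ε + η`
  calc _ ≤ _ := hullAP_triangle hf hg hh hk
    _ ≤ (η : ℝ≥0∞) / 2 + ENNReal.ofReal ε + (η : ℝ≥0∞) / 2 := add_le_add (add_le_add ht1 ht2) ht3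
    _ = ENNReal.ofReal ε + η := by
      rw [add_comm ((η : ℝ≥0∞) / 2), add_assoc, ENNReal.add_halves]

end Summit.NavierStokesRegularity.NavierStokesRegularity.Theorems
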